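import Literature.NumberTheory.Automorphic.IntegratedOperator      -- ★ `ContRepresentation.integratedOperator`, `integratedOperator_apply`, `integrable_smul_apply`
import Literature.NumberTheory.Automorphic.HaarConjCompact         -- ★ `map_mul_right_eq_self_of_mem_isCompact` (a left Haar measure is right-invariant under a compact subgroup)
import Mathlib.MeasureTheory.Integral.Prod
import HarnessLib

/-!
# The bi-`K`-average of a test function over a compact subgroup, and its integrated operator on `K`-trivial representations
# (Labesse–Langlands 1979, Lemma 6.1 p. 768; Borel–Jacquet 1979 §4.1 — `f ↦ e_K ⋆ f ⋆ e_K`)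

Topic `NumberTheory/Automorphic`; namespace `Literature.NumberTheory.Automorphic`.  KERNEL ONLY: theorems, 0 definitions, 0 named facts, 0 `sorry` (the average is
written INLINE as `g ↦ ∫ p : K × K, ψ (p.1 · g · p.2) d(μK ⊗ μK)`).  Cell `hodgecm-mathlib`, floor 0, programme P3, typer topic T1 (the GENERIC half of sub-goal (β)(b)
«bi-`K_c`-average with the same operator on `K_c`-trivial representations» of the arch line `Lines-draft/T1a_ArchCharactersLinIndep.lean`, typ-T1a (g0)); seat
F0P3-p01 (g9).

SETTING.  `G` a second countable locally compact group with a left Haar measure `ν`, `K ≤ G` a COMPACT subgroup with a finite measure `μK` on `↥K` invariant under left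
and right translations (its normalised Haar measure in the application), `ψ ∈ C_c(G)`.  The bi-`K`-average `ψ♮(g) = ∫_{K×K} ψ(k₁ g k₂) dμK(k₁) dμK(k₂)`:
* `continuous_biAverage`, `hasCompactSupport_biAverage` (support in `K · supp ψ · K`) — so `ψ♮ ∈ C_c(G)`;
* `biAverage_mul_left ∕ biAverage_mul_right` — `ψ♮(k g) = ψ♮(g) = ψ♮(g k)` for `k ∈ K`;
* `integral_smul_apply_conj_eq` — `∫ ψ(k₁ g k₂) π(g) v dν(g) = ∫ ψ(g) π(g) v dν(g)` for `k₁, k₂ ∈ K` when `π` is trivial on `K`;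
* **`integratedOperator_biAverage_eq`** — for a unitary strongly continuous `π` on a Hilbert space with `π(k) = 1` for all `k ∈ K` and `μK ⊗ μK` a probability measure:
  `π(ψ♮) = π(ψ)` (integrated operators w.r.t. `ν`).  Proof: Fubini over `G × (K × K)` (continuous compactly supported integrand), the substitution
  `g ↦ k₁⁻¹ g k₂⁻¹` (left invariance of `ν`; right invariance under the compact `K`, ★ `map_mul_right_eq_self_of_mem_isCompact`), `π(k₁⁻¹ g k₂⁻¹) v = π(g) v`.
  This is the operator-level content of «`B` is stable under `f ↦ e_K ⋆ f ⋆ e_K`» [LabesseLanglands1979, Lemma 6.1 p. 768] ∕ [BorelJacquet1979, §4.1];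
  [DeitmarEchterhoff2014, Lemma 1.6.3] for the translation calculus.

## References
* J.-P. Labesse, R. P. Langlands, *L-indistinguishability for SL(2)*, Canad. J. Math. 31 (1979), Lemma 6.1 p. 768 [LabesseLanglands1979].
* A. Borel, H. Jacquet, *Automorphic forms and automorphic representations*, PSPM 33.1 (1979), §4.1 [BorelJacquet1979].
* A. Deitmar, S. Echterhoff, *Principles of Harmonic Analysis*, 2nd ed. (2014), Lemma 1.6.3 [DeitmarEchterhoff2014].
-/

set_option autoImplicit false

noncomputable section

open MeasureTheory Measure Set Filter Topology CompactlySupported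
open scoped Pointwise

namespace Literature.NumberTheory.Automorphic

variable {G : Type*} [Group G] [TopologicalSpace G] [IsTopologicalGroup G] [SecondCountableTopology G] [MeasurableSpace G] [BorelSpace G]
  (K : Subgroup G) [MeasurableSpace K] [BorelSpace K] (μK : Measure K)

/-! ## §1 The bi-`K`-average of a continuous compactly supported function -/

section Average

variable {ψ : G → ℂ}

omit [MeasurableSpace G] [BorelSpace G] in
/-- **`ψ♮` is continuous** (`K` compact, `ψ` continuous; `G` locally compact and second countable): a parametric integral over the compact `K × K` of a jointly
continuous integrand (Mathlib `continuous_parametric_integral_of_continuous`). [cite: DeitmarEchterhoff2014, Lemma 1.6.3] -/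
theorem continuous_biAverage [LocallyCompactSpace G] (hK : IsCompact (K : Set G))
    [IsFiniteMeasureOnCompacts μK] [SFinite μK] (hψ : Continuous ψ) :
    Continuous fun g : G => ∫ p : K × K, ψ ((p.1 : G) * g * (p.2 : G)) ∂(μK.prod μK) := by
  haveI : CompactSpace K := isCompact_iff_compactSpace.1 hK
  haveI : SecondCountableTopology K := TopologicalSpace.Subtype.secondCountableTopology (K : Set G)
  have hFc : Continuous (Function.uncurry fun (g : G) (p : K × K) => ψ ((p.1 : G) * g * (p.2 : G))) :=
    hψ.comp (((continuous_subtype_val.comp (continuous_fst.comp continuous_snd)).mul continuous_fst).mul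
      (continuous_subtype_val.comp (continuous_snd.comp continuous_snd)))
  have h := continuous_parametric_integral_of_continuous (μ := μK.prod μK) hFc isCompact_univ
  simpa only [Measure.restrict_univ] using h

omit [SecondCountableTopology G] [MeasurableSpace G] [BorelSpace G] [BorelSpace K] in
/-- **`ψ♮` has compact support**, inside `K · supp ψ · K`. [cite: DeitmarEchterhoff2014, Lemma 1.6.3] -/
theorem hasCompactSupport_biAverage (hK : IsCompact (K : Set G)) (hψs : HasCompactSupport ψ) :
    HasCompactSupport fun g : G => ∫ p : K × K, ψ ((p.1 : G) * g * (p.2 : G)) ∂(μK.prod μK) := by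
  refine HasCompactSupport.intro ((hK.mul hψs.isCompact).mul hK) fun g hg => ?_
  refine integral_eq_zero_of_ae (Eventually.of_forall fun p => ?_)
  have hnot : (p.1 : G) * g * (p.2 : G) ∉ tsupport ψ := by
    intro hmem
    apply hg
    refine ⟨(p.1 : G)⁻¹ * ((p.1 : G) * g * (p.2 : G)), Set.mul_mem_mul (K.inv_mem p.1.2) hmem, (p.2 : G)⁻¹, K.inv_mem p.2.2, ?_⟩
    group
  exact image_eq_zero_of_notMem_tsupport hnot

omit [MeasurableSpace G] [BorelSpace G] in
/-- **`ψ♮(k g) = ψ♮(g)`** for `k ∈ K`: the change of variables `k₁ ↦ k₁ k` on the first factor (right invariance of `μK`; the map is a measure-preserving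
homeomorphism of `K × K`). [cite: BorelJacquet1979, §4.1] -/
theorem biAverage_mul_left [SFinite μK] [μK.IsMulRightInvariant] (ψ : G → ℂ) {k : G} (hk : k ∈ K) (g : G) :
    (∫ p : K × K, ψ ((p.1 : G) * (k * g) * (p.2 : G)) ∂(μK.prod μK)) = ∫ p : K × K, ψ ((p.1 : G) * g * (p.2 : G)) ∂(μK.prod μK) := by
  haveI : SecondCountableTopology K := TopologicalSpace.Subtype.secondCountableTopology (K : Set G)
  -- `T (k₁, k₂) = (k₁ k, k₂)` preserves `μK ⊗ μK`
  have hT : MeasurePreserving (fun p : K × K => (p.1 * ⟨k, hk⟩, p.2)) (μK.prod μK) (μK.prod μK) :=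
    (measurePreserving_mul_right μK (⟨k, hk⟩ : K)).prod (MeasurePreserving.id μK)
  have hTe : MeasurableEmbedding fun p : K × K => (p.1 * ⟨k, hk⟩, p.2) :=
    ((Homeomorph.mulRight (⟨k, hk⟩ : K)).prodCongr (Homeomorph.refl K)).measurableEmbedding
  rw [← hT.integral_comp hTe (fun p : K × K => ψ ((p.1 : G) * g * (p.2 : G)))]
  refine integral_congr_ae (Eventually.of_forall fun p => ?_)
  simp only [Subgroup.coe_mul, mul_assoc]

omit [MeasurableSpace G] [BorelSpace G] in
/-- **`ψ♮(g k) = ψ♮(g)`** for `k ∈ K` (left invariance of `μK` on the second factor). [cite: BorelJacquet1979, §4.1] -/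
theorem biAverage_mul_right [SFinite μK] [μK.IsMulLeftInvariant] (ψ : G → ℂ) {k : G} (hk : k ∈ K) (g : G) :
    (∫ p : K × K, ψ ((p.1 : G) * (g * k) * (p.2 : G)) ∂(μK.prod μK)) = ∫ p : K × K, ψ ((p.1 : G) * g * (p.2 : G)) ∂(μK.prod μK) := by
  haveI : SecondCountableTopology K := TopologicalSpace.Subtype.secondCountableTopology (K : Set G)
  have hT : MeasurePreserving (fun p : K × K => (p.1, ⟨k, hk⟩ * p.2)) (μK.prod μK) (μK.prod μK) :=
    (MeasurePreserving.id μK).prod (measurePreserving_mul_left μK (⟨k, hk⟩ : K))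
  have hTe : MeasurableEmbedding fun p : K × K => (p.1, ⟨k, hk⟩ * p.2) :=
    ((Homeomorph.refl K).prodCongr (Homeomorph.mulLeft (⟨k, hk⟩ : K))).measurableEmbedding
  rw [← hT.integral_comp hTe (fun p : K × K => ψ ((p.1 : G) * g * (p.2 : G)))]
  refine integral_congr_ae (Eventually.of_forall fun p => ?_)
  simp only [Subgroup.coe_mul, mul_assoc]

end Average

/-! ## §2 The integrated operator of the bi-`K`-average on a `K`-trivial representation -/

section Operator

variable {H : Type*} [NormedAddCommGroup H] [InnerProductSpace ℂ H] [CompleteSpace H] {π : ContRepresentation ℂ G H}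
  (ν : Measure G) [ν.IsHaarMeasure]

omit [MeasurableSpace K] [BorelSpace K] [CompleteSpace H] in
/-- **`∫ ψ(k₁ g k₂) π(g) v dν(g) = ∫ ψ(g) π(g) v dν(g)`** for `k₁, k₂` in a compact subgroup `K` on which `π` is trivial: substitute `g ↦ k₁⁻¹ g` (left invariance of
`ν`) and `g ↦ g k₂⁻¹` (right invariance of the left Haar measure `ν` under the COMPACT `K`, ★ `map_mul_right_eq_self_of_mem_isCompact`), then
`π(k₁⁻¹ g k₂⁻¹) v = π(g) v`. [cite: DeitmarEchterhoff2014, Lemma 1.6.3] -/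
theorem integral_smul_apply_conj_eq [LocallyCompactSpace G]
    (hK : IsCompact (K : Set G)) (hπK : ∀ k ∈ K, ∀ w : H, π k w = w) (ψ : G → ℂ) (v : H) {k₁ k₂ : G} (hk₁ : k₁ ∈ K) (hk₂ : k₂ ∈ K) :
    (∫ g, ψ (k₁ * g * k₂) • π g v ∂ν) = ∫ g, ψ g • π g v ∂ν := by
  -- left: `g ↦ k₁ g`
  have h1 : (∫ g, ψ (k₁ * g * k₂) • π g v ∂ν) = ∫ g, ψ (g * k₂) • π (k₁⁻¹ * g) v ∂ν := by
    rw [← integral_mul_left_eq_self (fun g => ψ (g * k₂) • π (k₁⁻¹ * g) v) k₁]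
    refine integral_congr_ae (Eventually.of_forall fun g => ?_)
    simp only [inv_mul_cancel_left]
  -- `π(k₁⁻¹ g) v = π(g) v`
  have h2 : (fun g => ψ (g * k₂) • π (k₁⁻¹ * g) v) = fun g => ψ (g * k₂) • π g v := by
    funext g
    rw [map_mul, ContinuousLinearMap.mul_def, ContinuousLinearMap.comp_apply, hπK k₁⁻¹ (K.inv_mem hk₁)]
  -- right: `g ↦ g k₂` (right invariance of `ν` under `K`)
  have hR : MeasurePreserving (fun g : G => g * k₂) ν ν := ⟨measurable_mul_const k₂, map_mul_right_eq_self_of_mem_isCompact ν hK hk₂⟩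
  have h3 : (∫ g, ψ (g * k₂) • π g v ∂ν) = ∫ g, ψ g • π (g * k₂⁻¹) v ∂ν := by
    rw [← hR.integral_comp (Homeomorph.mulRight k₂).measurableEmbedding (fun g => ψ g • π (g * k₂⁻¹) v)]
    refine integral_congr_ae (Eventually.of_forall fun g => ?_)
    simp only [mul_inv_cancel_right]
  have h4 : (fun g => ψ g • π (g * k₂⁻¹) v) = fun g => ψ g • π g v := by
    funext g
    rw [map_mul, ContinuousLinearMap.mul_def, ContinuousLinearMap.comp_apply, hπK k₂⁻¹ (K.inv_mem hk₂)]
  rw [h1, h2, h3, h4]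

/-- **`π(ψ♮) = π(ψ)` ON A `K`-TRIVIAL REPRESENTATION** (`π` unitary strongly continuous on a Hilbert space with `π(k) = 1` for `k ∈ K`; `ν` a left Haar measure; `K`
compact with `μK ⊗ μK` a probability measure invariant under left and right translations): the bi-`K`-average has the same integrated operator as `ψ`.
Fubini over `G × (K × K)` for the continuous compactly supported integrand `(g, k₁, k₂) ↦ ψ(k₁ g k₂) π(g) v`, then `integral_smul_apply_conj_eq` fibrewise.
[cite: LabesseLanglands1979, Lemma 6.1 p. 768] [cite: BorelJacquet1979, §4.1] -/
theorem integratedOperator_biAverage_eq [LocallyCompactSpace G]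
    (hK : IsCompact (K : Set G)) [IsProbabilityMeasure μK] (hu : π.IsUnitary) (hc : π.IsStronglyContinuous)
    (hπK : ∀ k ∈ K, ∀ w : H, π k w = w) (ψ : C_c(G, ℂ)) (ψav : C_c(G, ℂ))
    (hψav : ∀ g, ψav g = ∫ p : K × K, ψ ((p.1 : G) * g * (p.2 : G)) ∂(μK.prod μK)) :
    π.integratedOperator hu hc ν ψav = π.integratedOperator hu hc ν ψ := by
  haveI : CompactSpace K := isCompact_iff_compactSpace.1 hK
  haveI : SecondCountableTopology K := TopologicalSpace.Subtype.secondCountableTopology (K : Set G)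
  ext v
  rw [ContRepresentation.integratedOperator_apply, ContRepresentation.integratedOperator_apply]
  -- the integrand on `G × (K × K)`
  set F : G → K × K → H := fun g p => ψ ((p.1 : G) * g * (p.2 : G)) • π g v with hF
  have hFc : Continuous (Function.uncurry F) := by
    refine Continuous.smul ?_ ?_
    · exact ψ.continuous.comp (((continuous_subtype_val.comp (continuous_fst.comp continuous_snd)).mul continuous_fst).mul
        (continuous_subtype_val.comp (continuous_snd.comp continuous_snd)))
    · exact (hc v).comp continuous_fst
  have hFs : HasCompactSupport (Function.uncurry F) := by
    refine HasCompactSupport.intro (((hK.mul ψ.hasCompactSupport.isCompact).mul hK).prod isCompact_univ) ?_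
    rintro ⟨g, p⟩ hgp
    have hg : g ∉ (K : Set G) * tsupport ⇑ψ * (K : Set G) := fun h => hgp (Set.mk_mem_prod h (Set.mem_univ _))
    have hnot : (p.1 : G) * g * (p.2 : G) ∉ tsupport ⇑ψ := by
      intro hmem
      apply hg
      refine ⟨(p.1 : G)⁻¹ * ((p.1 : G) * g * (p.2 : G)), Set.mul_mem_mul (K.inv_mem p.1.2) hmem, (p.2 : G)⁻¹, K.inv_mem p.2.2, ?_⟩
      group
    simp only [Function.uncurry_apply_pair, hF, image_eq_zero_of_notMem_tsupport hnot, zero_smul]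
  have hFi : Integrable (Function.uncurry F) (ν.prod (μK.prod μK)) := hFc.integrable_of_hasCompactSupport hFs
  -- `ψ♮(g) • π(g) v = ∫_{K×K} F g p`
  have hstep1 : (fun g => ψav g • π g v) = fun g => ∫ p : K × K, F g p ∂(μK.prod μK) := by
    funext g
    rw [hψav g, hF]
    exact (integral_smul_const _ _).symm
  rw [hstep1, integral_integral_swap hFi]
  -- fibrewise `∫_G F g p dν = π(ψ) v`
  have hfib : ∀ p : K × K, (∫ g, F g p ∂ν) = ∫ g, ψ g • π g v ∂ν := fun p =>
    integral_smul_apply_conj_eq K ν hK hπK ψ v p.1.2 p.2.2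
  simp_rw [hfib]
  rw [integral_const, probReal_univ, one_smul]

end Operator

end Literature.NumberTheory.Automorphic

end
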